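import Literature.Analysis.FluidPDE.KNSSRegularityGalilean
import Literature.Analysis.FluidPDE.NSBoundedMildOseenClassical
import Literature.Analysis.FluidPDE.SpaceTimeCalculus
import HarnessLib

/-!
# KNSS 2009, §4: the regularity of bounded mild solutions from Proposition 4.1 and the
# vorticity equation (4.8) — named facts and the proved glue

Analysis/FluidPDE facts file on the discharge path of
`Literature.Analysis.FluidPDE.KNSS2009_regularity_boundedWeak_ancient` (Koch–Nadirashvili–
Seregin–Šverák, Acta Math. 203 (2009) = arXiv:0709.3599v1, §4 for bounded weak solutions on
`ℝ³ × (−∞, 0)`). After `KNSSRegularityAncient` (ancient ⇐ window), `KNSSRegularityDecomposition`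
(window ⇐ Lemma 3.1 in drift-mild form + drift-mild regularity), `KNSSRegularityGalilean` (the
drift is a Galilean artefact: drift-mild regularity ⇐ Galilean covariance + regularity of bounded
mild solutions `KNSS2009_mild_regularity`) and `KNSSRegularityGalileanProofs` (Galilean
covariance, proved), the analytic content left on this path is the regularity of bounded
(restarted) mild solutions. This file splits it along the two printed ingredients the source
names, and PROVES the glue:

* `KNSS2009_prop41_mild` — **Proposition 4.1 with the quantitative estimate (4.6)**, rendered
  for the tree's restarted-mild fields (`IsKNSSDriftMild T N V 0`): joint smoothness on
  `(0, T) × ℝ³` and, on every short window `N²(t − s) < ε(k)` from a time `s` of the window,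
  `(t−s)^{k/2}‖∇ᵏV(t)‖ ≤ C(k)N` (`l = 0`) and the time-integrated `l = 1` estimate
  `(t−s)^{k/2+1}‖∇ᵏV(t') − ∇ᵏV(t)‖ ≤ C(k)N(t' − t)`;
* `KNSS2009_vorticity48_mild` — **the vorticity equation (4.8)** for smooth restarted-mild
  fields, in the time-integrated pointwise form of the window/ancient facts;
* `KNSS2009_mild_regularity_of_prop41 : prop41 → vorticity48 → KNSS2009_mild_regularity`
  (**proved**: uniform constants `C(k, δ)`, `L(k, δ)` on `(δ, T)` by covering `(δ, T)` with short
  windows of the fixed length `h = min(δ, ε(k)/(N²+1))`; divergence-freeness at *every* time from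
  a.e. time by joint continuity of the divergence, `isDivFree_of_ae_isWeaklyDivFree_of_smooth`),
  and the compositions `KNSS2009_regularity_boundedWeak_window_of_prop41`,
  `KNSS2009_regularity_boundedWeak_ancient_of_prop41` (with the Galilean covariance as an explicit
  hypothesis, discharged by `IsKNSSDriftMild.galileanCovariance_R3` of
  `KNSSRegularityGalileanProofs`).

`KNSS2009_prop41_mild` is the smoothing theory of `L^∞` mild solutions (Giga–Inui–Matsui,
Giga–Sawada; the object of the tree's `NSBoundedMildOseen` fact (P) in the `oseenKernel`
vocabulary and of the `OseenHeatCommute` layer — "derivatives fall on the data" — in the present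
`oseenHeat` vocabulary); `KNSS2009_vorticity48_mild` is, for smooth fields, "mild ⇒ weak"
(`OseenDuhamelWeakStokes`) followed by the projected momentum equation
(`integral_inner_momentum_eq_zero_of_slab_weak`), the pressure (`PressureReconstruction`) and the
classical vorticity equation (`IsClassicalNSSolutionOn.vorticity_eq`), to be assembled in a
sibling proofs file.

## References

* G. Koch, N. Nadirashvili, G. Seregin, V. Šverák, *Liouville theorems for the Navier–Stokes
  equations and applications*, Acta Math. 203 (2009) 83–105 = arXiv:0709.3599v1, §4 p. 8:
  (i) mild solutions, Proposition 4.1 with (4.6), and the closing paragraph with (4.8)–(4.11).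
  [KochNadirashviliSereginSverak2009]
* Y. Giga, K. Inui, S. Matsui, *On the Cauchy problem for the Navier–Stokes equations with
  nondecaying initial data*, Quaderni di Matematica 4 (1999), Thm. 1 — smoothness of `L^∞` mild
  solutions (the reference behind KNSS's [Giga]).
-/

noncomputable section

open MeasureTheory Set Function Filter TopologicalSpace InnerProductSpace Metric
open _root_.Topology
open scoped RealInnerProductSpace Laplacian ContDiff NNReal ENNReal Interval

namespace Literature.Analysis.FluidPDE

section Facts

/-- **KNSS 2009, Proposition 4.1 with (4.6), for bounded mild solutions restarted at every
time** (Acta Math. 203 (2009) = arXiv:0709.3599v1, §4 p. 8: "Let `u ∈ L^∞_{x,t}(ℝⁿ × (0,T))` be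
a mild solution of (4.1) and (4.2) with `u₀ ∈ L^∞`. Then for `k, l = 0, 1, …` the functions
`t^{k/2+l}∇ᵏₓ∂ₜˡu` are bounded and, for `T' = ε(k,l)‖u₀‖^{-2}_{L^∞(ℝⁿ)}` (where `ε(k,l) > 0`
is a small constant), we have (4.6) `‖t^{k/2+l}∇ᵏₓ∂ₜˡu‖_{L^∞(ℝⁿ×(0,T'))} ≤ C(k,l)‖u₀‖_{L^∞(ℝⁿ)}`";
proof there after Giga–Sawada, Dong–Du, Germain–Pavlović–Staffilani; joint smoothness of bounded
mild solutions: Giga–Inui–Matsui 1999, Thm. 1 (iii)). **Statement** (`n = 3`, `ν = 1`), for the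
restarted-mild fields of the tree (`IsKNSSDriftMild T N V 0`: `V` jointly measurable, bounded by
`N` on `(0, T) × ℝ³`, weakly divergence free at a.e. time, with
`V(t) = e^{(t−s)Δ}V(s) − ∫ₛᵗ e^{(t−σ)Δ}P∇·(V⊗V)(σ) dσ` pointwise for all `0 < s < t < T` — on each
window `(s, T)` a mild solution from the datum `V(s)`, `‖V(s)‖_∞ ≤ N`, in the sense of §4 (i)):
`V` is jointly `C^∞` on `(0, T) × ℝ³`, and for every `k` there are universal `ε(k) > 0`, `C(k)`
such that for all `0 < s < t < T` with `N²(t − s) < ε(k)` (i.e. `t − s < T' = ε‖V(s)‖^{-2}`):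
`(t−s)^{k/2}‖∇ᵏₓV(t, x)‖ ≤ C(k) N` ((4.6), `l = 0`) and, for `t ≤ t' < T` with
`N²(t' − s) < ε(k)`, `(t−s)^{k/2+1}‖∇ᵏₓV(t', x) − ∇ᵏₓV(t, x)‖ ≤ C(k) N (t' − t)` ((4.6), `l = 1`,
integrated in time over `[t, t']` with the monotone weight). Weaker than printed (the datum norm
is replaced by its bound `N` in both `T'` and the right-hand side, and `l ≤ 1`). [cite: KochNadirashviliSereginSverak2009, Prop. 4.1 with (4.6) (arXiv:0709.3599v1 p. 8)] -/
def KNSS2009_prop41_mild : Prop :=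
  ∀ k : ℕ, ∃ ε : ℝ, 0 < ε ∧ ∃ C : ℝ, 0 ≤ C ∧
    ∀ ⦃T N : ℝ⦄ ⦃V : ℝ → EuclideanSpace ℝ (Fin 3) → EuclideanSpace ℝ (Fin 3)⦄,
      IsKNSSDriftMild T N V 0 →
        IsSmoothSpaceTimeOn (Ioo 0 T) V ∧
        ∀ s ∈ Ioo 0 T, ∀ t ∈ Ioo s T, N ^ 2 * (t - s) < ε →
          (∀ x, (t - s) ^ ((k : ℝ) / 2) * ‖iteratedFDeriv ℝ k (V t) x‖ ≤ C * N) ∧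
          (∀ t' ∈ Ico t T, N ^ 2 * (t' - s) < ε → ∀ x,
            (t - s) ^ ((k : ℝ) / 2 + 1) *
              ‖iteratedFDeriv ℝ k (V t') x - iteratedFDeriv ℝ k (V t) x‖ ≤ C * N * (t' - t))

/-- **KNSS 2009, §4 (4.8): the vorticity equation of a smooth bounded mild solution, in
time-integrated form** (Acta Math. 203 (2009) = arXiv:0709.3599v1, §4 p. 8: "For `n = 3` the
equation for `ω` is (4.8) `ω_{i,t} − Δω_i = ∂_j(ω_j u_i − ω_i u_j)` and it is easy to check that in
our situation this equation is satisfied in the sense of distributions"; for a jointly smooth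
divergence-free field this is the classical vorticity equation `ωₜ = Δω − (u·∇)ω + (ω·∇)u`).
**Statement** (`n = 3`, `ν = 1`). If `V` is restarted-mild on `(0, T)` with some bound
(`IsKNSSDriftMild T N V 0`) and jointly `C^∞` on `(0, T) × ℝ³`, then for all `x` and
`0 < s ≤ t < T`, with `ω = curl V`:
`ω(t, x) − ω(s, x) = ∫ₛᵗ (Δω(τ, ·)(x) − Dω(τ, ·)(x)[V(τ, x)] + DV(τ, ·)(x)[ω(τ, x)]) dτ`.
(Mechanism: a bounded mild solution is a bounded weak solution — the Duhamel integral is a weak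
Stokes solution, `OseenDuhamelWeakStokes` — so, being smooth, it solves the projected momentum
equation, has a pressure, and its curl solves (4.8) classically.) [cite: KochNadirashviliSereginSverak2009, §4 (4.8) (arXiv:0709.3599v1 p. 8)] -/
def KNSS2009_vorticity48_mild : Prop :=
  ∀ ⦃T N : ℝ⦄ ⦃V : ℝ → EuclideanSpace ℝ (Fin 3) → EuclideanSpace ℝ (Fin 3)⦄,
    IsKNSSDriftMild T N V 0 → IsSmoothSpaceTimeOn (Ioo 0 T) V →
      ∀ x, ∀ s t : ℝ, 0 < s → s ≤ t → t < T →
        curl (V t) x - curl (V s) x =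
          ∫ τ in s..t, ((Δ (curl (V τ))) x - fderiv ℝ (curl (V τ)) x (V τ x) +
            fderiv ℝ (V τ) x (curl (V τ) x))

end Facts

/-! ### Divergence-freeness at every time from a.e. time, for jointly smooth fields -/

section DivFree

variable {E : Type*} [NormedAddCommGroup E] [InnerProductSpace ℝ E] [FiniteDimensional ℝ E]
  [MeasurableSpace E] [BorelSpace E]

/-- A jointly smooth field on an open time interval whose slices are weakly divergence free for
a.e. time is divergence free at every time (the divergence is jointly continuous and vanishes
a.e. in `t` for each `x`). [folklore] -/
theorem isDivFree_of_ae_isWeaklyDivFree_of_smooth {V : ℝ → E → E} {a b : ℝ}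
    (hV : IsSmoothSpaceTimeOn (Ioo a b) V)
    (hae : ∀ᵐ t ∂((volume : Measure ℝ).restrict (Ioo a b)), IsWeaklyDivFree (V t))
    {t : ℝ} (ht : t ∈ Ioo a b) : VectorCalculus.IsDivFree (V t) := by
  intro x
  -- `τ ↦ div V(τ)(x)` is continuous on `(a, b)`
  have hcont : ContinuousOn (fun τ => VectorCalculus.divergence (V τ) x) (Ioo a b) := by
    have hD : ContinuousOn (fun z : ℝ × E => fderiv ℝ (V z.1) z.2) (Ioo a b ×ˢ univ) :=
      hV.continuousOn_fderiv_slice isOpen_Ioo.uniqueDiffOn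
    have hι : ContinuousOn (fun τ : ℝ => ((τ, x) : ℝ × E)) (Ioo a b) :=
      (continuous_id.prodMk continuous_const).continuousOn
    have hc := hD.comp hι fun τ hτ => mk_mem_prod hτ (mem_univ x)
    have hL : Continuous fun A : E →L[ℝ] E => LinearMap.trace ℝ E (A : E →ₗ[ℝ] E) :=
      ((LinearMap.trace ℝ E).comp (ContinuousLinearMap.coeLM ℝ)).continuous_of_finiteDimensional
    exact hL.comp_continuousOn hc
  -- and vanishes at a.e. time
  have hzero : (fun τ => VectorCalculus.divergence (V τ) x) =ᵐ[volume.restrict (Ioo a b)]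
      fun _ => (0 : ℝ) := by
    filter_upwards [hae, ae_restrict_mem measurableSet_Ioo] with τ hτ hτI
    exact (hτ.isDivFree_of_contDiff (contDiff_infty.1 (hV.contDiff_slice hτI) 1)) x
  exact Measure.eqOn_open_of_ae_eq hzero isOpen_Ioo hcont continuousOn_const ht

end DivFree

/-! ### The regularity of bounded mild solutions from Proposition 4.1 and (4.8) -/

section Glue

/-- Elementary: for `0 < a` and `r`, `a ^ r > 0`-rescaling of a weighted bound. [folklore] -/
theorem le_mul_rpow_neg_of_rpow_mul_le {a r X B : ℝ} (ha : 0 < a) (h : a ^ r * X ≤ B) :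
    X ≤ B * a ^ (-r) := by
  have hpos : 0 < a ^ r := Real.rpow_pos_of_pos ha r
  rw [Real.rpow_neg ha.le, ← div_eq_mul_inv, le_div_iff₀ hpos, mul_comm]
  exact h

/-- **KNSS's §4 regularity of bounded mild solutions (`KNSS2009_mild_regularity`) from
Proposition 4.1 with (4.6) (`KNSS2009_prop41_mild`) and the vorticity equation (4.8)
(`KNSS2009_vorticity48_mild`).** The constants: with `h = min(δ, ε(k)/(N²+1))` every
`t ∈ (δ, T)` lies in the short window from `s = t − h/2` (`N²(t − s) < ε(k)`), so (4.6) with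
`l = 0` gives `‖∇ᵏV(t)‖ ≤ C(k)N(h/2)^{-k/2}`; for the Lipschitz clause, times at distance `< h/2`
lie in a common short window ((4.6), `l = 1`, integrated), and times at distance `≥ h/2` are
handled by the crude bound `2 sup‖∇ᵏV‖ ≤ (4 sup‖∇ᵏV‖/h)|t − s|`. Smoothness of slices is joint
smoothness; `div V(t) = 0` at *every* `t` because the divergence is jointly continuous and
vanishes at a.e. `t` (`isDivFree_of_ae_isWeaklyDivFree_of_smooth`). [cite: KochNadirashviliSereginSverak2009, §4 (4.8)–(4.11) with Prop. 4.1 (arXiv:0709.3599v1 p. 8)] -/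
theorem KNSS2009_mild_regularity_of_prop41 (h41 : KNSS2009_prop41_mild)
    (h48 : KNSS2009_vorticity48_mild) : KNSS2009_mild_regularity := by
  intro N T hT
  -- constants of Proposition 4.1, for every `k`
  choose ε hε C hC0 hP using h41
  -- the window length `h k δ` and the bounds
  set hh : ℕ → ℝ → ℝ := fun k δ => min δ (ε k / (N ^ 2 + 1)) with hhdef
  set CC : ℕ → ℝ → ℝ := fun k δ => C k * |N| * (hh k δ / 2) ^ (-((k : ℝ) / 2)) with hCC
  set LL : ℕ → ℝ → ℝ := fun k δ =>
    max (C k * |N| * (hh k δ / 2) ^ (-((k : ℝ) / 2 + 1))) (4 * CC k δ / hh k δ) with hLL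
  refine ⟨CC, LL, fun V hV => ?_⟩
  have hN : 0 ≤ N := hV.nonneg
  have hNabs : |N| = N := abs_of_nonneg hN
  obtain ⟨hsmooth, -⟩ := hP 0 hV
  have hslice : ∀ t ∈ Ioo 0 T, ContDiff ℝ ∞ (V t) := fun t ht => hsmooth.contDiff_slice ht
  have hdiv : ∀ t ∈ Ioo 0 T, VectorCalculus.IsDivFree (V t) := fun t ht =>
    isDivFree_of_ae_isWeaklyDivFree_of_smooth hsmooth hV.ae_isWeaklyDivFree ht
  -- facts about the window length
  have hh_pos : ∀ k {δ : ℝ}, 0 < δ → 0 < hh k δ := fun k δ hδ =>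
    lt_min hδ (div_pos (hε k) (by positivity))
  have hh_le : ∀ k (δ : ℝ), hh k δ ≤ δ := fun k δ => min_le_left _ _
  have hh_small : ∀ k (δ : ℝ), N ^ 2 * hh k δ < ε k := by
    intro k δ
    have h1 : hh k δ ≤ ε k / (N ^ 2 + 1) := min_le_right _ _
    calc N ^ 2 * hh k δ ≤ N ^ 2 * (ε k / (N ^ 2 + 1)) := mul_le_mul_of_nonneg_left h1 (sq_nonneg N)
      _ < ε k := by
          rw [mul_div_assoc', div_lt_iff₀ (by positivity)]
          nlinarith [hε k, sq_nonneg N]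
  -- (4.6), `l = 0`, at a point of `(δ, T)`
  have hbound : ∀ δ : ℝ, 0 < δ → ∀ k : ℕ, ∀ t ∈ Ioo δ T, ∀ x,
      ‖iteratedFDeriv ℝ k (V t) x‖ ≤ CC k δ := by
    intro δ hδ k t ht x
    have hpos := hh_pos k hδ
    set s : ℝ := t - hh k δ / 2 with hs
    have hs0 : 0 < s := by have := hh_le k δ; rw [hs]; linarith [ht.1]
    have hsT : s ∈ Ioo 0 T := ⟨hs0, by rw [hs]; linarith [ht.2]⟩
    have hst : t ∈ Ioo s T := ⟨by rw [hs]; linarith, ht.2⟩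
    have hsmall : N ^ 2 * (t - s) < ε k := by
      have : t - s = hh k δ / 2 := by rw [hs]; ring
      rw [this]; nlinarith [hh_small k δ, sq_nonneg N, hpos]
    obtain ⟨-, hk⟩ := hP k hV
    obtain ⟨h0, -⟩ := hk s hsT t hst hsmall
    have := h0 x
    have hts : t - s = hh k δ / 2 := by rw [hs]; ring
    rw [hts] at this
    have hX := le_mul_rpow_neg_of_rpow_mul_le (by positivity) this
    simpa [hCC, hNabs] using hX
  refine ⟨hslice, hdiv, hbound, ?_, fun x s t hs hst htT => h48 hV hsmooth x s t hs hst htT⟩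
  -- the Lipschitz clause
  intro δ hδ k s hs t ht x
  have hpos := hh_pos k hδ
  have hCC0 : 0 ≤ CC k δ := (norm_nonneg _).trans (hbound δ hδ k t ht x)
  -- symmetric reduction to `s ≤ t`
  wlog hle : s ≤ t generalizing s t
  · have := this t ht s hs (le_of_not_ge hle)
    rwa [norm_sub_rev, abs_sub_comm] at this
  rcases lt_or_ge (t - s) (hh k δ / 2) with hclose | hfar
  · -- close times: a common short window from `s₀ = s − h/2`
    set s₀ : ℝ := s - hh k δ / 2 with hs₀
    have hs₀0 : 0 < s₀ := by have := hh_le k δ; rw [hs₀]; linarith [hs.1]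
    have hs₀T : s₀ ∈ Ioo 0 T := ⟨hs₀0, by rw [hs₀]; linarith [hs.2]⟩
    have hss₀ : s ∈ Ioo s₀ T := ⟨by rw [hs₀]; linarith, hs.2⟩
    have hsm1 : N ^ 2 * (s - s₀) < ε k := by
      have : s - s₀ = hh k δ / 2 := by rw [hs₀]; ring
      rw [this]; nlinarith [hh_small k δ, sq_nonneg N, hpos]
    have hsm2 : N ^ 2 * (t - s₀) < ε k := by
      have : t - s₀ < hh k δ := by rw [hs₀]; linarith
      calc N ^ 2 * (t - s₀) ≤ N ^ 2 * hh k δ := mul_le_mul_of_nonneg_left this.le (sq_nonneg N)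
        _ < ε k := hh_small k δ
    obtain ⟨-, hk⟩ := hP k hV
    obtain ⟨-, h1⟩ := hk s₀ hs₀T s hss₀ hsm1
    have := h1 t ⟨hle, ht.2⟩ hsm2 x
    have hts : s - s₀ = hh k δ / 2 := by rw [hs₀]; ring
    rw [hts] at this
    have hX := le_mul_rpow_neg_of_rpow_mul_le (by positivity) this
    rw [abs_of_nonneg (sub_nonneg.2 hle)]
    calc ‖iteratedFDeriv ℝ k (V t) x - iteratedFDeriv ℝ k (V s) x‖
        ≤ C k * N * (t - s) * (hh k δ / 2) ^ (-((k : ℝ) / 2 + 1)) := hX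
      _ = (C k * |N| * (hh k δ / 2) ^ (-((k : ℝ) / 2 + 1))) * (t - s) := by rw [hNabs]; ring
      _ ≤ LL k δ * (t - s) := mul_le_mul_of_nonneg_right (le_max_left _ _) (sub_nonneg.2 hle)
  · -- far times: crude bound
    rw [abs_of_nonneg (sub_nonneg.2 hle)]
    have h2 : ‖iteratedFDeriv ℝ k (V t) x - iteratedFDeriv ℝ k (V s) x‖ ≤ 2 * CC k δ :=
      (norm_sub_le _ _).trans (by linarith [hbound δ hδ k t ht x, hbound δ hδ k s hs x])
    calc ‖iteratedFDeriv ℝ k (V t) x - iteratedFDeriv ℝ k (V s) x‖ ≤ 2 * CC k δ := h2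
      _ ≤ (4 * CC k δ / hh k δ) * (t - s) := by
          rw [div_mul_eq_mul_div, le_div_iff₀ hpos]
          nlinarith
      _ ≤ LL k δ * (t - s) := mul_le_mul_of_nonneg_right (le_max_right _ _) (sub_nonneg.2 hle)

/-- **The window regularity fact from Lemma 3.1, Galilean covariance, Proposition 4.1 and (4.8).**
[cite: KochNadirashviliSereginSverak2009, §4 closing paragraph with Lemma 3.1 and Prop. 4.1 (arXiv:0709.3599v1 pp. 7–8)] -/
theorem KNSS2009_regularity_boundedWeak_window_of_prop41 (h31 : KNSS2009_weak_driftMild)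
    (hK : IsKNSSDriftMild.GalileanCovariance (EuclideanSpace ℝ (Fin 3)))
    (h41 : KNSS2009_prop41_mild) (h48 : KNSS2009_vorticity48_mild) :
    KNSS2009_regularity_boundedWeak_window :=
  KNSS2009_regularity_boundedWeak_window_of_mild h31 hK (KNSS2009_mild_regularity_of_prop41 h41 h48)

/-- **The ancient regularity fact** (the §4 input of KNSS's Theorems 5.2–5.3) **from Lemma 3.1,
Galilean covariance, Proposition 4.1 and (4.8).**
[cite: KochNadirashviliSereginSverak2009, §5 proof of Thm 5.2, first sentence (arXiv:0709.3599v1 p. 10), with §4 and Lemma 3.1] -/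
theorem KNSS2009_regularity_boundedWeak_ancient_of_prop41 (h31 : KNSS2009_weak_driftMild)
    (hK : IsKNSSDriftMild.GalileanCovariance (EuclideanSpace ℝ (Fin 3)))
    (h41 : KNSS2009_prop41_mild) (h48 : KNSS2009_vorticity48_mild) :
    KNSS2009_regularity_boundedWeak_ancient :=
  KNSS2009_regularity_boundedWeak_ancient_of_mild h31 hK (KNSS2009_mild_regularity_of_prop41 h41 h48)

end Glue

end Literature.Analysis.FluidPDE

end
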